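import Summits.BirchSwinnertonDyer.BirchSwinnertonDyer.Theorems.PrintCf2SplitBadTwoLocSurjTwistedSlackVLine
import Summits.BirchSwinnertonDyer.BirchSwinnertonDyer.Theorems.PrintCf2SplitBadTwoSignRetwistOnDecomp
import Summits.BirchSwinnertonDyer.BirchSwinnertonDyer.Theorems.PrintCf2SplitBadTwoLocSurjSignTwist
import Summits.BirchSwinnertonDyer.BirchSwinnertonDyer.Theorems.PrintCf2SplitBadTwoQuadraticSignRamification
import HarnessLib

/-!
# Crux `PrintCf2.SplitBadTwoRankOneOfFacts` (stmt-BirchSwinnertonDyer-20368), M-LINE-PIN stub (R) `stub_xRegularInner`: (LSₙ)(A_θ) ON THE `v`-LINE OF A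
# DA7 FRAME FOR EVERY QUADRATIC `θ`, EVERY LAYER `n ≥ 1`, FROM THE (B1) READING ALONE — the sign trichotomy on `D_v̄` (B3)/(B1)/(B2) done inside

Cell `bsd-print-cf2`, WIDTH seat `bsd-line-cf2-p1-w2` g15 (prover-bsd-line-cf2-p1-w2-g15-0); `--supports` helper (Theses-free).
HONEST FRAMING: nothing here closes the crux or a registered stub — ONE displayed hypothesis `hB1` (the twisted INERT `v̄`-reading in case (B1),
discharged in the sequel `…XRegularInnerOfInertReading` by -w4 g14's line-generic B5-T assembly) remains; BSD is not proved by any of this; no summit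
statement is proved by this seat. No definition, no named fact, no `sorry`.

WHAT. `K` imaginary quadratic with `disc K = −7`, `2 = v v̄`, `κ₁` the `ℤ₂`-line unramified outside `v` with topological generator `γ₁`, `U_n = κ₁.layerSubgroup n`,
`n ≥ 1`; `θ` a quadratic framed character with sign `ε` (p706294). Trichotomy on `ε|_{D_v̄}`:
* (B3) `ε ≢ 1` on `U_n ⊓ D_v̄` ⟹ `hB5T` of `LayerShapiroSlack.locSurj_layers_twisted_slack_vLine` holds by its RIGHT disjunct at every `w′ ∣ v̄`
  (**`forall_exists_stabilizer_sign_ne_one_of_subgroup`**: `𝔓 = g • 𝔓₀`, `s = g s₀ g⁻¹`);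
* (B1) `ε|_{D_v̄} = 1` ⟹ the displayed `hB1`;
* (B2) otherwise ⟹ `ε = χ_{κ₁}` on `D_v̄` and the re-twist `θ₀ = θ ⊗ χ_{κ₁}` (my p711201 `XRegClose.exists_retwist_agree_on_layer_sign_trivial_on_decomp`, with
  `τ ∈ D_v̄`, `κ₁ τ = κ₁ γ₁` from cf2c-w8 g4 `LinePin.exists_mem_decomp_vbar_apply_eq_of_discr`) is (B1) and agrees with `θ` on `U_n`; transport back by
  -w4 g14 `SignTwist.locSurj_charModule_of_unitChar_eq_on` (p708344).
**`locSurj_layers_charModule_vLine_of_decompReading (d) (hK) (hdisc) (hv hvbar hne) (κ₁) (hκ₁) (hγ₁) (n) (hn) (hB1) (θ) (hθ)`** — conclusion VERBATIM the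
`(LS_n)` body of -w6 g7's socket `XRegInner.stub_xRegularInner_of_locSurjLayers₁` (p707323) at `charModule ∅ θ`. (The `v̄`-line twin is -w8 g5's
`locSurj_layers_charModule_of_decompReading`.) presearch: Greenberg LNM 1716 §4 p. 107 (twists by characters of the layer group), Washington §13.1; no new fact.
beyond-print theorem: no.

References: [GreenbergVatsal2000] §2 Prop. 2.1; [GreenbergLNM1716] §4 p. 107, Props. 4.13–4.15; [Washington1997] §13.1; [KellerYin2024] §1.1.
-/

noncomputable section

open scoped Classical ContRepresentation Pointwise

set_option linter.dupNamespace false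
set_option autoImplicit false

open CategoryTheory NumberField IsDedekindDomain Field ValuativeRel
open Literature.NumberTheory.EllipticCurves Literature.NumberTheory.EllipticCurves.GreenbergSelmer
open Literature.NumberTheory.EllipticCurves.GreenbergVatsal2000 Literature.NumberTheory.EllipticCurves.KellerYin2024
open Literature.NumberTheory.GaloisRepresentations Literature.NumberTheory.GaloisRepresentations.LocalWeilDatum
open Literature.NumberTheory.GaloisRepresentations.DiscreteGaloisModule (SelmerStructure mu MuCarrier TateDual tateDual
  coindTateDualMor coindTateDualHom)
open Literature.NumberTheory.GaloisCohomology
open Literature.NumberTheory.IwasawaTheory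
open Summit.BirchSwinnertonDyer.Rank1Residual.X11b.LocBridge
open Summit.BirchSwinnertonDyer.BirchSwinnertonDyer.Theorems Summit.BirchSwinnertonDyer.BirchSwinnertonDyer.Theorems.PrintCf2

namespace Summit.BirchSwinnertonDyer.BirchSwinnertonDyer.Theorems.PrintCf2.LayerShapiroSlack

variable {K : Type} [Field K] [NumberField K]

/-! ## §3. The `v`-LINE at `p = 2`: (LSₙ)(A_θ) for EVERY quadratic `θ`, `n ≥ 1`, from the (B1) reading alone -/

/-- Case (a)/(B3), `U`-generic form of `XRegClose.forall_exists_stabilizer_sign_ne_one`: a sign `ε` non-trivial at some `s₀ ∈ U ⊓ D_v̄` is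
non-trivial at a stabiliser `s ∈ U` of SOME prime `𝔓` above EVERY place `w′ ∣ v̄` of `F′`. [cite: NeukirchANT1999, Ch. I §9 Prop. (9.1), (9.6)] -/
theorem forall_exists_stabilizer_sign_ne_one_of_subgroup (U : Subgroup (absoluteGaloisGroup K)) [U.Normal]
    (F' : IntermediateField K (AlgebraicClosure K)) [NumberField F'] (ε : absoluteGaloisGroup K →* ℤˣ) {vbar : HeightOneSpectrum (𝓞 K)}
    (h : ∃ s ∈ U, s ∈ decomp (K := K) vbar ∧ ε s ≠ 1) (w' : vbar.Extension (𝓞 F')) :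
    ∃ 𝔓 : Ideal (absIntegers (𝓞 K) K),
      𝔓.comap (ringOfIntegersToIntegralClosure (k := K) (Ω := AlgebraicClosure K) F') = w'.1.asIdeal ∧
      ∃ s ∈ U, ε s ≠ 1 ∧ s • 𝔓 = 𝔓 := by
  obtain ⟨s₀, hs₀U, hs₀D, hs₀ε⟩ := h
  obtain ⟨𝔓, h𝔓prime, h𝔓w⟩ := KummerU.exists_prime_absIntegers_comap_eq (K := K) F' w'.1
  haveI := h𝔓prime
  have h𝔓 : 𝔓 ∈ vbar.primesAbove := by
    have hunder := KummerU.comap_algebraMap_eq_under_of_comap_eq F' h𝔓w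
    have hmem : 𝔓 ∈ (w'.1.under (𝓞 K)).primesAbove := HeightOneSpectrum.mem_primesAbove_iff.2 ⟨h𝔓prime, ⟨hunder.symm⟩⟩
    rwa [w'.2] at hmem
  obtain ⟨g, hg⟩ := HeightOneSpectrum.exists_smul_eq_of_mem_primesAbove_holds (K := K) (v := vbar)
    (adicCompletionPrime_mem_primesAbove K vbar) h𝔓
  have hs₀P : s₀ ∈ (adicCompletionPrime K vbar).decompositionSubgroup (absoluteGaloisGroup K) := by
    rw [decompositionSubgroup_adicCompletionPrime_eq_range]; exact hs₀D
  refine ⟨𝔓, h𝔓w, g * s₀ * g⁻¹, Subgroup.Normal.conj_mem inferInstance s₀ hs₀U g, ?_, ?_⟩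
  · rwa [map_mul, map_mul, map_inv, mul_inv_cancel_comm]
  · have hmem : g * s₀ * g⁻¹ ∈ 𝔓.decompositionSubgroup (absoluteGaloisGroup K) := by
      rw [← hg, Ideal.decompositionSubgroup_smul]
      exact Subgroup.smul_mem_pointwise_smul _ _ _ hs₀P
    exact (Ideal.mem_decompositionSubgroup_iff).mp hmem

/-- **(LSₙ)(A_θ) ON THE `v`-LINE OF A DA7 FRAME, EVERY QUADRATIC `θ`, EVERY LAYER `n ≥ 1`, FROM THE (B1) READING ALONE** (with slack `d`).
`K` imaginary quadratic with `disc K = −7`, `2 = v v̄`, `κ₁` the `ℤ₂`-line unramified outside `v` with topological generator `γ₁` (so `v̄` is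
undecomposed in it), `U_n = κ₁.layerSubgroup n`. Displayed: `hB1` = the twisted `v̄`-reading `hB5T` of `locSurj_layers_twisted_slack_vLine` for
every quadratic `θ′` whose sign `ε′` is TRIVIAL ON `D_v̄` (case (B1); to be supplied by the twisted INERT `v̄`-reading with slack `d = n`).
Trichotomy on `ε = sign θ` (p706294): (B3) `ε ≢ 1` on `U_n ⊓ D_v̄` ⟹ `hB5T` by `forall_exists_stabilizer_sign_ne_one_of_subgroup` (right disjunct);
(B1) ⟹ `hB1`; (B2) ⟹ re-twist `θ₀ = θ ⊗ χ_{κ₁}` (`XRegClose.exists_retwist_agree_on_layer_sign_trivial_on_decomp`, `τ ∈ D_v̄` with `κ₁ τ = κ₁ γ₁`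
from cf2c-w8 g4 `LinePin.exists_mem_decomp_vbar_apply_eq_of_discr`), (B1) for `θ₀`, transport back by -w4 g14 `SignTwist.locSurj_charModule_of_unitChar_eq_on`.
Conclusion VERBATIM the `(LS_n)` body of -w6 g7's socket `XRegInner.stub_xRegularInner_of_locSurjLayers₁_of_nontrivial` (p710611).
[cite: GreenbergVatsal2000, §2 Prop. 2.1] [cite: GreenbergLNM1716, §4 p. 107, Props. 4.13–4.15] [cite: Washington1997, §13.1] -/
theorem locSurj_layers_charModule_vLine_of_decompReading (d : ℕ) (hK : IsImaginaryQuadratic K) (hdisc : NumberField.discr K = -7)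
    {v vbar : HeightOneSpectrum (𝓞 K)} (hv : ((2 : ℕ) : 𝓞 K) ∈ v.asIdeal) (hvbar : ((2 : ℕ) : 𝓞 K) ∈ vbar.asIdeal) (hne : vbar ≠ v)
    (κ₁ : ZpExtension K 2) (hκ₁ : κ₁.IsUnramifiedOutside v) {γ₁ : absoluteGaloisGroup K} (hγ₁ : κ₁.IsTopGenerator γ₁)
    (n : ℕ) (hn : 1 ≤ n) [Fintype (absoluteGaloisGroup K ⧸ κ₁.layerSubgroup n)]
    (hB1 : ∀ (θ' : FramedGaloisRep K (padicCoeffIntegers (∅ : Set (PadicAlgCl 2))) 1), (∀ σ : absoluteGaloisGroup K, θ' σ ^ 2 = 1) →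
      ∀ (ε' : absoluteGaloisGroup K →* ℤˣ),
      (haveI : Fact (Nat.Prime 2) := ⟨Nat.prime_two⟩; ∀ σ, ε' σ = 1 ↔ unitChar θ' σ = 1) →
      IsOpen ((ε'.ker : Subgroup (absoluteGaloisGroup K)) : Set (absoluteGaloisGroup K)) →
      (∀ σ ∈ decomp (K := K) vbar, ε' σ = 1) →
      ∀ (F' : IntermediateField K (AlgebraicClosure K)) [FiniteDimensional K F'] [IsAbelianGalois K F'] [NumberField F']
      [(galFixing K F').Normal] (hU' : galFixing K F' ≤ κ₁.layerSubgroup n) (_hεU' : ∀ u ∈ galFixing K F', ε' u = 1)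
      (_hker : ∀ u ∈ κ₁.layerSubgroup n, ε' u = 1 → u ∈ galFixing K F')
      (M : ℕ) {N : Type} [AddCommGroup N] [DistribMulAction (absoluteGaloisGroup K) N] [TopologicalSpace N] [DiscreteTopology N]
      [Finite N] {N' : Type} [AddCommGroup N'] [DistribMulAction (absoluteGaloisGroup K) N'] [TopologicalSpace N'] [DiscreteTopology N']
      (hN : ∀ m : N, IsOpen {σ : absoluteGaloisGroup K | σ • m = m}) (hN' : ∀ m : N', IsOpen {σ : absoluteGaloisGroup K | σ • m = m})
      (_hNε : ∀ (σ : absoluteGaloisGroup K) (x : N), σ • x = ((ε' σ : ℤˣ) : ℤ) • x)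
      (_hMN : ∀ x : N, 2 ^ M • x = 0) (_hMN' : ∀ x : N', 2 ^ M • x = 0)
      (B : N →+ N' →+ MuCarrier K (2 ^ M))
      (hB : ∀ (σ : absoluteGaloisGroup K) (m : N) (m' : N'), B (ofSMul N hN σ m) (ofSMul N' hN' σ m') = mu K (2 ^ M) σ (B m m'))
      (_hBbij : Function.Bijective fun m' : N' ↦ B.flip m')
      (ι' : N' →+ Additive (AlgebraicClosure K)ˣ) (_hι'inj : Function.Injective ι')
      (_hι' : ∀ (g : absoluteGaloisGroup K) (x : N'), Additive.toMul (ι' (g • x)) = (g • Additive.toMul (ι' x)) ^ ((ε' g : ℤˣ) : ℤ))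
      (m₀ : N) (_hι'B : ∀ m' : N', Additive.toMul (ι' m') = muVal K (2 ^ M) (B m₀ m'))
      {s : absoluteGaloisGroup K ⧸ κ₁.layerSubgroup n → absoluteGaloisGroup K}
      (hs : ∀ y, (s y : absoluteGaloisGroup K ⧸ κ₁.layerSubgroup n) = y)
      (hs1 : s ((1 : absoluteGaloisGroup K) : absoluteGaloisGroup K ⧸ κ₁.layerSubgroup n) = 1)
      (φ : contOneCocycles (discreteTopRep (κ₁.layerSubgroup n) N')),
      galoisCohomology.localization (((ofSMul N hN).coind (κ₁.layerSubgroup n) (κ₁.isOpen_layerSubgroup n)).tateDual (2 ^ M))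
          (Sum.inr vbar) 1
          (cohomologyMap (coindTateDualMor (ofSMul N hN) (ofSMul N' hN') (κ₁.layerSubgroup n) B (κ₁.isOpen_layerSubgroup n) hB) 1
            (shapiroLift (ofSMul N' hN').toTopRep (κ₁.layerSubgroup n) (κ₁.isOpen_layerSubgroup n) hs hs1 (oneCocycleClass _ φ))) ∈
        (LocalInvariants.canonical K (2 ^ M)).dualLocalCondition ((ofSMul N hN).coind (κ₁.layerSubgroup n) (κ₁.isOpen_layerSubgroup n))
          (Sum.inr vbar)
          (DiscreteGaloisModule.unramifiedSubgroup
            (GaloisRep.toLocal vbar ((ofSMul N hN).coind (κ₁.layerSubgroup n) (κ₁.isOpen_layerSubgroup n))) 1) →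
      ∀ β : (AlgebraicClosure K)ˣ,
        (∀ u : galFixing K F', Additive.toMul (ι' (φ.1 ⟨u, hU' u.2⟩)) = (u : absoluteGaloisGroup K) • β / β) →
        ∀ b : F', ((b : F') : AlgebraicClosure K) = ((β ^ 2 ^ M : (AlgebraicClosure K)ˣ) : AlgebraicClosure K) →
        ∀ w' : vbar.Extension (𝓞 F'),
          ((2 ^ (M - d) : ℕ) : ℤ) ∣ WithZero.log (w'.1.valuation F' b) ∨
          ∃ 𝔓 : Ideal (absIntegers (𝓞 K) K),
            𝔓.comap (ringOfIntegersToIntegralClosure (k := K) (Ω := AlgebraicClosure K) F') = w'.1.asIdeal ∧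
            ∃ s ∈ κ₁.layerSubgroup n, ε' s ≠ 1 ∧ s • 𝔓 = 𝔓)
    (θ : FramedGaloisRep K (padicCoeffIntegers (∅ : Set (PadicAlgCl 2))) 1) (hθ : ∀ σ : absoluteGaloisGroup K, θ σ ^ 2 = 1) :
    ∀ (T : Finset (HeightOneSpectrum (𝓞 K))), (∀ w ∈ T, ((2 : ℕ) : 𝓞 K) ∉ w.asIdeal ∨ w = vbar) →
      ∀ τ : (w : HeightOneSpectrum (𝓞 K)) →
        DoubleCoset.Quotient (decomp (K := K) w : Set (absoluteGaloisGroup K)) (κ₁.layerSubgroup n : Set (absoluteGaloisGroup K)) →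
          subgroupH1 (decompIn (κ₁.layerSubgroup n) w) (charModule (∅ : Set (PadicAlgCl 2)) θ),
      ∃ z : subgroupH1 (κ₁.layerSubgroup n) (charModule (∅ : Set (PadicAlgCl 2)) θ),
        (∀ w ∈ T, ∀ q : DoubleCoset.Quotient (decomp (K := K) w : Set (absoluteGaloisGroup K))
            (κ₁.layerSubgroup n : Set (absoluteGaloisGroup K)),
          resOfLe (charModule (∅ : Set (PadicAlgCl 2)) θ) (inertiaIn_le_decompIn (κ₁.layerSubgroup n) w)
            (resH1Hom (decompInToH (κ₁.layerSubgroup n) w) (AddMonoidHom.id (charModule (∅ : Set (PadicAlgCl 2)) θ)) (fun _ _ ↦ rfl)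
              (conjH1 (κ₁.layerSubgroup n) (charModule (∅ : Set (PadicAlgCl 2)) θ) q.out z) - τ w q) = 0) ∧
        (∀ w : HeightOneSpectrum (𝓞 K), w ∉ T → (((2 : ℕ) : 𝓞 K) ∉ w.asIdeal ∨ w = vbar) →
          ∀ σ : absoluteGaloisGroup K, conjH1 (κ₁.layerSubgroup n) (charModule (∅ : Set (PadicAlgCl 2)) θ) σ z ∈
            GreenbergVatsal2000.unramifiedKer (κ₁.layerSubgroup n) (charModule (∅ : Set (PadicAlgCl 2)) θ) w) := by
  haveI : Fact (Nat.Prime 2) := ⟨Nat.prime_two⟩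
  have hall : ∀ w : HeightOneSpectrum (𝓞 K), ((2 : ℕ) : 𝓞 K) ∈ w.asIdeal → w = v ∨ w = vbar :=
    fun w hw ↦ CMPrimes.eq_or_eq_of_two_mem (K := K) hK.1 hv hvbar hne hw
  -- the generic step: (LS_n)(A_θ′) for a quadratic θ′ whose sign is trivial on `D_v̄` OR non-trivial on `U_n ⊓ D_v̄`
  have key : ∀ (θ' : FramedGaloisRep K (padicCoeffIntegers (∅ : Set (PadicAlgCl 2))) 1) (hθ' : ∀ σ : absoluteGaloisGroup K, θ' σ ^ 2 = 1)
      (ε' : absoluteGaloisGroup K →* ℤˣ), (∀ σ, ε' σ = 1 ↔ unitChar θ' σ = 1) →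
      IsOpen ((ε'.ker : Subgroup (absoluteGaloisGroup K)) : Set (absoluteGaloisGroup K)) →
      (∀ (σ : absoluteGaloisGroup K) (a : charModule (∅ : Set (PadicAlgCl 2)) θ'), σ • a = ((ε' σ : ℤˣ) : ℤ) • a) →
      ((∀ σ ∈ decomp (K := K) vbar, ε' σ = 1) ∨ (∃ s ∈ κ₁.layerSubgroup n, s ∈ decomp (K := K) vbar ∧ ε' s ≠ 1)) →
      ∀ (T : Finset (HeightOneSpectrum (𝓞 K))), (∀ w ∈ T, ((2 : ℕ) : 𝓞 K) ∉ w.asIdeal ∨ w = vbar) →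
      ∀ τ : (w : HeightOneSpectrum (𝓞 K)) →
        DoubleCoset.Quotient (decomp (K := K) w : Set (absoluteGaloisGroup K)) (κ₁.layerSubgroup n : Set (absoluteGaloisGroup K)) →
          subgroupH1 (decompIn (κ₁.layerSubgroup n) w) (charModule (∅ : Set (PadicAlgCl 2)) θ'),
      ∃ z : subgroupH1 (κ₁.layerSubgroup n) (charModule (∅ : Set (PadicAlgCl 2)) θ'),
        (∀ w ∈ T, ∀ q : DoubleCoset.Quotient (decomp (K := K) w : Set (absoluteGaloisGroup K))
            (κ₁.layerSubgroup n : Set (absoluteGaloisGroup K)),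
          resOfLe (charModule (∅ : Set (PadicAlgCl 2)) θ') (inertiaIn_le_decompIn (κ₁.layerSubgroup n) w)
            (resH1Hom (decompInToH (κ₁.layerSubgroup n) w) (AddMonoidHom.id (charModule (∅ : Set (PadicAlgCl 2)) θ')) (fun _ _ ↦ rfl)
              (conjH1 (κ₁.layerSubgroup n) (charModule (∅ : Set (PadicAlgCl 2)) θ') q.out z) - τ w q) = 0) ∧
        (∀ w : HeightOneSpectrum (𝓞 K), w ∉ T → (((2 : ℕ) : 𝓞 K) ∉ w.asIdeal ∨ w = vbar) →
          ∀ σ : absoluteGaloisGroup K, conjH1 (κ₁.layerSubgroup n) (charModule (∅ : Set (PadicAlgCl 2)) θ') σ z ∈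
            GreenbergVatsal2000.unramifiedKer (κ₁.layerSubgroup n) (charModule (∅ : Set (PadicAlgCl 2)) θ') w) := by
    intro θ' hθ' ε' hiff' hε'open hAε' hcase
    -- the finite ramification set of `θ′`
    have hfin := KummerUDict.finite_setOf_not_isUnramifiedAt_of_sq_eq_one θ' hθ'
    have hSε : ∀ w : HeightOneSpectrum (𝓞 K), w ∉ hfin.toFinset → ((2 : ℕ) : 𝓞 K) ∉ w.asIdeal →
        ∀ τ ∈ GreenbergSelmer.inertia w, ε' τ = 1 := by
      intro w hw _ τ hτ
      have hunr : θ'.IsUnramifiedAt w := by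
        by_contra h
        exact hw (hfin.mem_toFinset.mpr h)
      exact (hiff' τ).2 ((KummerUDict.unitChar_eq_one_iff_apply_eq_one θ' τ).2
        (KummerUDict.forall_inertia_apply_eq_one_of_isUnramifiedAt θ' hunr τ hτ))
    refine locSurj_layers_twisted_slack_vLine d hK hv hvbar hne hall κ₁ hκ₁ ε' hε'open hfin.toFinset hSε
      (fun a ↦ GreenbergSelmer.isOpen_stabilizer_cofree _ θ' a) hAε' (charModuleEquiv θ') n ?_
    intro F' _ _ _ _ hU' hεU' hker M N _ _ _ _ _ N' _ _ _ _ hN hN' hNε hMN hMN' B hB hBbij ι' hι'inj hι' m₀ hι'B s hs hs1 φ hφ β hβ b hb w'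
    rcases hcase with hB1case | hB3case
    · exact hB1 θ' hθ' ε' hiff' hε'open hB1case F' hU' hεU' hker M hN hN' hNε hMN hMN' B hB hBbij ι' hι'inj hι' m₀ hι'B hs hs1 φ hφ β hβ b hb w'
    · exact Or.inr (forall_exists_stabilizer_sign_ne_one_of_subgroup (κ₁.layerSubgroup n) F' ε' hB3case w')
  -- the sign of `θ` and the trichotomy
  obtain ⟨ε, -, hiff, hεopen, hAε⟩ := KummerUDict.exists_signHom_of_sq_eq_one θ hθ
  by_cases hB3 : ∃ s ∈ κ₁.layerSubgroup n, s ∈ decomp (K := K) vbar ∧ ε s ≠ 1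
  · exact key θ hθ ε hiff hεopen hAε (Or.inr hB3)
  by_cases hB1' : ∀ σ ∈ decomp (K := K) vbar, ε σ = 1
  · exact key θ hθ ε hiff hεopen hAε (Or.inl hB1')
  -- (B2): re-twist by the quadratic character of the `v`-line
  push Not at hB3 hB1'
  obtain ⟨σ₀, hσ₀D, hσ₀⟩ := hB1'
  have hεU : ∀ u ∈ κ₁.layerSubgroup n, u ∈ decomp (K := K) vbar → ε u = 1 := hB3
  obtain ⟨τ, hτD, hτ⟩ := LinePin.exists_mem_decomp_vbar_apply_eq_of_discr hK hdisc hv hvbar hne κ₁ hκ₁ hγ₁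
  have hτU : τ⁻¹ * γ₁ ∈ κ₁.layerSubgroup n := by
    apply κ₁.kerSubgroup_le_layerSubgroup n
    rw [ZpExtension.mem_kerSubgroup, map_mul, map_inv, hτ, inv_mul_cancel]
  obtain ⟨θ₀, hθ₀2, hθ₀U, -, hθ₀D⟩ := XRegClose.exists_retwist_agree_on_layer_sign_trivial_on_decomp κ₁ hγ₁ hn hτD hτU θ hθ ε hiff
    hεU ⟨σ₀, hσ₀D, hσ₀⟩
  obtain ⟨ε₀, -, hiff₀, hε₀open, hAε₀⟩ := KummerUDict.exists_signHom_of_sq_eq_one θ₀ hθ₀2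
  have hLS₀ := key θ₀ hθ₀2 ε₀ hiff₀ hε₀open hAε₀ (Or.inl (hθ₀D ε₀ hiff₀))
  exact SignTwist.locSurj_charModule_of_unitChar_eq_on θ₀ θ hθ₀2 hθ (κ₁.layerSubgroup n) hθ₀U _ hLS₀

end Summit.BirchSwinnertonDyer.BirchSwinnertonDyer.Theorems.PrintCf2.LayerShapiroSlack

end
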